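import Summits.AtomisticToContinuum.BoseEinsteinCondensation.Theses.BECLiebAntibunching
import Literature.MathematicalPhysics.QuantumManyBody.BoseGasDirichletWall

/-!
# Strategist r1 companion file for crux `BECLiebAntibunching.AntibunchingGS`
(item stmt-AtomisticToContinuum-10239; seat planner-cstrat-stmt-AtomisticToContinuum-10239-r1-0, 2026-08-17)

Typed objects referred to in `STRATEGY-CENSUS.md`:

* `pairDensity`, `IsPosTIGroundState`, `CruxNF`, `cruxNF_iff` — the crux in bundled normal form;
* § Decomposition D2: `BoundedPairExcess` (the L¹ hole control that `AntibunchingPalmGlue` actually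
  consumes), `ExcessEquidistribution` (sup of the excess ≤ C·(1/N + cell-mean of the excess)),
  the PROVED assembly `antibunchingGS_of_split`, and the converse directions
  `boundedPairExcess_of_crux`, `excessEquidistribution_of_crux` (both pieces are consequences of the
  crux; neither alone is the crux);
* § Strengthen: `SharpAntibunching` (Lieb's `g₂ ≤ 1` with the sharp canonical constant),
  `PairAsymptoticsWithRate` (thermodynamic limit of `P` with rate `1/N` and a nonpositive
  correction) with `antibunchingGS_of_sharp`, `antibunchingGS_of_pairAsymptotics`.

No `sorry`. Nothing here is filed as an item; the census explains why (every split leaves the far-field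
sign control at precision `1/N` in one piece, which has no plan).
-/

namespace Summit.AtomisticToContinuum.BoseEinsteinCondensation.Cruxes.AntibunchingGS.StrategistR1

open MeasureTheory Filter
open scoped ENNReal NNReal
open Literature.MathematicalPhysics.QuantumManyBody.BoseGas
open Summit.AtomisticToContinuum.BoseEinsteinCondensation.Theses.BECLiebAntibunching

noncomputable section

/-- Translation-averaged Born pair density `P(y) = L³ ∫_{cell^{n+1}} |Ψ(x₂+y, x₂, X')|² dX` of a
periodic `(n+2)`-body state at density `ρ` (`L = sideLength ρ (n+2)`); cell-mean `1`, `≡ 1` for the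
free gas, `g₂ = (1 - 1/N) P`. [cite: Lieb1963] -/
def pairDensity (ρ : ℝ) (n : ℕ) (Ψ : PeriodicTrialState (n + 2) (sideLength ρ (n + 2)))
    (y : Space) : ℝ≥0∞ :=
  ENNReal.ofReal (sideLength ρ (n + 2) ^ 3) *
    ∫⁻ X in cellN (n + 1) (sideLength ρ (n + 2)), (‖Ψ.ψ (Matrix.vecCons (X 0 + y) X)‖₊ : ℝ≥0∞) ^ 2

/-- The three hypotheses of the crux on `Ψ`: exact periodic ground state, positive real,
translation invariant. [folklore] -/
def IsPosTIGroundState (v : ℝ → ℝ≥0∞) (ρ : ℝ) (n : ℕ)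
    (Ψ : PeriodicTrialState (n + 2) (sideLength ρ (n + 2))) : Prop :=
  periodicEnergy v Ψ = periodicGroundStateEnergy v (n + 2) (sideLength ρ (n + 2)) ∧
  (∀ X, 0 < (Ψ.ψ X).re ∧ (Ψ.ψ X).im = 0) ∧
  (∀ (X : Config (n + 2)) (t : Space), Ψ.ψ (fun i => X i + t) = Ψ.ψ X)

/-- The crux in bundled normal form. [cite: Lieb1963] -/
def CruxNF : Prop :=
  ∀ v : ℝ → ℝ≥0∞, IsRepulsiveFiniteRange v → (∃ M : NNReal, ∀ r, v r ≤ M) →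
    ∃ ρ₀ : ℝ, 0 < ρ₀ ∧ ∀ ρ : ℝ, 0 < ρ → ρ < ρ₀ → ∃ C : ℝ, ∀ᶠ n : ℕ in atTop,
      ∀ Ψ : PeriodicTrialState (n + 2) (sideLength ρ (n + 2)), IsPosTIGroundState v ρ n Ψ →
        ∀ y : Space, pairDensity ρ n Ψ y ≤ ENNReal.ofReal (1 + C / (n + 2))

theorem cruxNF_iff : CruxNF ↔ AntibunchingGS := by
  simp only [CruxNF, AntibunchingGS, IsPosTIGroundState, pairDensity, and_imp]

/-! ## § Decomposition D2 — L¹ excess + equidistribution of the excess -/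

/-- D2 piece 1 (`BoundedPairExcess`, the L¹ hole control the route's glue actually uses):
`∫_cell (P - 1)₊ ≤ C L³ / N`, i.e. `ρ ∫ (g₂ - 1)₊ = O(1)`; by the exact sum rule `∫_cell (P - 1) = 0`
it is the same as "the correlation hole has volume `≤ C/ρ`". (Truncated subtraction in `ℝ≥0∞` IS the
positive part.) [cite: Lieb1963] -/
def BoundedPairExcess : Prop :=
  ∀ v : ℝ → ℝ≥0∞, IsRepulsiveFiniteRange v → (∃ M : NNReal, ∀ r, v r ≤ M) →
    ∃ ρ₀ : ℝ, 0 < ρ₀ ∧ ∀ ρ : ℝ, 0 < ρ → ρ < ρ₀ → ∃ C : ℝ, 0 ≤ C ∧ ∀ᶠ n : ℕ in atTop,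
      ∀ Ψ : PeriodicTrialState (n + 2) (sideLength ρ (n + 2)), IsPosTIGroundState v ρ n Ψ →
        ∫⁻ y in cell (sideLength ρ (n + 2)), (pairDensity ρ n Ψ y - 1) ≤
          ENNReal.ofReal (C / (n + 2)) * ENNReal.ofReal (sideLength ρ (n + 2)) ^ 3

/-- D2 piece 2 (`ExcessEquidistribution`, a reverse-Hölder / no-mesoscopic-bunching statement):
the pointwise excess is controlled by `1/N` plus the cell-MEAN of the excess,
`(P(y) - 1)₊ ≤ C (1/N + L⁻³ ∫_cell (P - 1)₊)`. [cite: Lieb1963] -/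
def ExcessEquidistribution : Prop :=
  ∀ v : ℝ → ℝ≥0∞, IsRepulsiveFiniteRange v → (∃ M : NNReal, ∀ r, v r ≤ M) →
    ∃ ρ₀ : ℝ, 0 < ρ₀ ∧ ∀ ρ : ℝ, 0 < ρ → ρ < ρ₀ → ∃ C : ℝ, 0 ≤ C ∧ ∀ᶠ n : ℕ in atTop,
      ∀ Ψ : PeriodicTrialState (n + 2) (sideLength ρ (n + 2)), IsPosTIGroundState v ρ n Ψ →
        ∀ y : Space, pairDensity ρ n Ψ y - 1 ≤
          ENNReal.ofReal C * (ENNReal.ofReal (1 / (n + 2)) +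
            (ENNReal.ofReal (sideLength ρ (n + 2)) ^ 3)⁻¹ *
              ∫⁻ z in cell (sideLength ρ (n + 2)), (pairDensity ρ n Ψ z - 1))

/-- Assembly of D2 (PROVED): the two pieces give the crux BY NAME with `C := C₂ (1 + C₁)`. [folklore] -/
theorem antibunchingGS_of_split : BoundedPairExcess → ExcessEquidistribution → AntibunchingGS := by
  intro h1 h2 v hv hM
  obtain ⟨ρ1, hρ1, H1⟩ := h1 v hv hM
  obtain ⟨ρ2, hρ2, H2⟩ := h2 v hv hM
  refine ⟨min ρ1 ρ2, lt_min hρ1 hρ2, fun ρ hρ hρlt => ?_⟩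
  obtain ⟨C1, hC1, E1⟩ := H1 ρ hρ (hρlt.trans_le (min_le_left _ _))
  obtain ⟨C2, hC2, E2⟩ := H2 ρ hρ (hρlt.trans_le (min_le_right _ _))
  refine ⟨C2 * (1 + C1), ?_⟩
  filter_upwards [E1, E2] with n hn1 hn2
  intro Ψ hE hpos hTI y
  have hGS : IsPosTIGroundState v ρ n Ψ := ⟨hE, hpos, hTI⟩
  have hLpos : 0 < sideLength ρ (n + 2) := sideLength_pos_of_pos hρ (by omega)
  have hA0 : ENNReal.ofReal (sideLength ρ (n + 2)) ^ 3 ≠ 0 :=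
    pow_ne_zero 3 ((ENNReal.ofReal_pos.2 hLpos).ne')
  have hAtop : ENNReal.ofReal (sideLength ρ (n + 2)) ^ 3 ≠ ⊤ :=
    ENNReal.pow_ne_top ENNReal.ofReal_ne_top
  have key1 := hn1 Ψ hGS
  have key2 := hn2 Ψ hGS y
  have hn0 : (0 : ℝ) < (n : ℝ) + 2 := by positivity
  change pairDensity ρ n Ψ y ≤ _
  calc pairDensity ρ n Ψ y
      ≤ (pairDensity ρ n Ψ y - 1) + 1 := le_tsub_add
    _ ≤ ENNReal.ofReal C2 * (ENNReal.ofReal (1 / (n + 2)) +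
          (ENNReal.ofReal (sideLength ρ (n + 2)) ^ 3)⁻¹ *
            ∫⁻ z in cell (sideLength ρ (n + 2)), (pairDensity ρ n Ψ z - 1)) + 1 :=
        add_le_add key2 le_rfl
    _ ≤ ENNReal.ofReal C2 * (ENNReal.ofReal (1 / (n + 2)) +
          (ENNReal.ofReal (sideLength ρ (n + 2)) ^ 3)⁻¹ *
            (ENNReal.ofReal (C1 / (n + 2)) * ENNReal.ofReal (sideLength ρ (n + 2)) ^ 3)) + 1 := by
        gcongr
    _ = ENNReal.ofReal C2 * (ENNReal.ofReal (1 / (n + 2)) + ENNReal.ofReal (C1 / (n + 2))) + 1 := by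
        congr 2
        rw [mul_comm (ENNReal.ofReal (C1 / (n + 2))), ← mul_assoc,
          ENNReal.inv_mul_cancel hA0 hAtop, one_mul]
    _ = ENNReal.ofReal (1 + C2 * (1 + C1) / (n + 2)) := by
        rw [← ENNReal.ofReal_add (by positivity) (by positivity), ← ENNReal.ofReal_mul hC2,
          ← ENNReal.ofReal_one, ← ENNReal.ofReal_add (by positivity) zero_le_one]
        congr 1
        field_simp
        ring

/-- Pointwise consequence of the crux in truncated-subtraction form. [folklore] -/
theorem excess_le_of_bound {a : ℝ≥0∞} {C : ℝ} {n : ℕ}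
    (h : a ≤ ENNReal.ofReal (1 + C / (n + 2))) :
    a - 1 ≤ ENNReal.ofReal (max C 0 / (n + 2)) := by
  rw [tsub_le_iff_right]
  have hn0 : (0 : ℝ) < (n : ℝ) + 2 := by positivity
  calc a ≤ ENNReal.ofReal (1 + C / (n + 2)) := h
    _ ≤ ENNReal.ofReal (1 + max C 0 / (n + 2)) := by
        apply ENNReal.ofReal_le_ofReal
        gcongr
        exact le_max_left _ _
    _ = ENNReal.ofReal (max C 0 / (n + 2)) + 1 := by
        rw [add_comm (1 : ℝ), ENNReal.ofReal_add (by positivity) zero_le_one, ENNReal.ofReal_one]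

/-- The crux implies D2 piece 1 (so piece 1 is a CONSEQUENCE of the crux, `C₁ := max C 0`). [folklore] -/
theorem boundedPairExcess_of_crux : AntibunchingGS → BoundedPairExcess := by
  intro h v hv hM
  obtain ⟨ρ₀, hρ₀, H⟩ := h v hv hM
  refine ⟨ρ₀, hρ₀, fun ρ hρ hlt => ?_⟩
  obtain ⟨C, HC⟩ := H ρ hρ hlt
  refine ⟨max C 0, le_max_right _ _, ?_⟩
  filter_upwards [HC] with n hn
  intro Ψ hGS
  have hpt : ∀ y, pairDensity ρ n Ψ y - 1 ≤ ENNReal.ofReal (max C 0 / (n + 2)) := fun y =>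
    excess_le_of_bound (hn Ψ hGS.1 hGS.2.1 hGS.2.2 y)
  calc ∫⁻ y in cell (sideLength ρ (n + 2)), (pairDensity ρ n Ψ y - 1)
      ≤ ∫⁻ _y in cell (sideLength ρ (n + 2)), ENNReal.ofReal (max C 0 / (n + 2)) :=
        lintegral_mono fun y => hpt y
    _ = ENNReal.ofReal (max C 0 / (n + 2)) * volume (cell (sideLength ρ (n + 2))) :=
        setLIntegral_const _ _
    _ = ENNReal.ofReal (max C 0 / (n + 2)) * ENNReal.ofReal (sideLength ρ (n + 2)) ^ 3 := by
        rw [volume_cell]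

/-- The crux implies D2 piece 2 (so piece 2 is a CONSEQUENCE of the crux, `C₂ := max C 0`). [folklore] -/
theorem excessEquidistribution_of_crux : AntibunchingGS → ExcessEquidistribution := by
  intro h v hv hM
  obtain ⟨ρ₀, hρ₀, H⟩ := h v hv hM
  refine ⟨ρ₀, hρ₀, fun ρ hρ hlt => ?_⟩
  obtain ⟨C, HC⟩ := H ρ hρ hlt
  refine ⟨max C 0, le_max_right _ _, ?_⟩
  filter_upwards [HC] with n hn
  intro Ψ hGS y
  have hn0 : (0 : ℝ) < (n : ℝ) + 2 := by positivity
  calc pairDensity ρ n Ψ y - 1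
      ≤ ENNReal.ofReal (max C 0 / (n + 2)) := excess_le_of_bound (hn Ψ hGS.1 hGS.2.1 hGS.2.2 y)
    _ = ENNReal.ofReal (max C 0) * ENNReal.ofReal (1 / (n + 2)) := by
        rw [← ENNReal.ofReal_mul (le_max_right _ _)]
        congr 1
        field_simp
    _ ≤ ENNReal.ofReal (max C 0) * (ENNReal.ofReal (1 / (n + 2)) +
          (ENNReal.ofReal (sideLength ρ (n + 2)) ^ 3)⁻¹ *
            ∫⁻ z in cell (sideLength ρ (n + 2)), (pairDensity ρ n Ψ z - 1)) := by
        gcongr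
        exact le_self_add

/-! ## § Strengthen — two rigid forms and why they feed the crux -/

/-- S⁺₁ `SharpAntibunching`: Lieb's `g₂ ≤ 1` verbatim at finite `N`, i.e. `P ≤ N/(N-1) = (n+2)/(n+1)`
(translation-averaged pair density `≤ ρ²`). Strictly stronger than the crux (`C = 1 + 1/(n+1)`),
at the mercy of the SIGN of the `O(1/N)` canonical finite-size corrections; no induction variable.
[cite: Lieb1963] -/
def SharpAntibunching : Prop :=
  ∀ v : ℝ → ℝ≥0∞, IsRepulsiveFiniteRange v → (∃ M : NNReal, ∀ r, v r ≤ M) →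
    ∃ ρ₀ : ℝ, 0 < ρ₀ ∧ ∀ ρ : ℝ, 0 < ρ → ρ < ρ₀ → ∀ᶠ n : ℕ in atTop,
      ∀ Ψ : PeriodicTrialState (n + 2) (sideLength ρ (n + 2)), IsPosTIGroundState v ρ n Ψ →
        ∀ y : Space, pairDensity ρ n Ψ y ≤ ENNReal.ofReal ((n + 2) / (n + 1))

theorem antibunchingGS_of_sharp : SharpAntibunching → AntibunchingGS := by
  intro h v hv hM
  obtain ⟨ρ₀, hρ₀, H⟩ := h v hv hM
  refine ⟨ρ₀, hρ₀, fun ρ hρ hlt => ⟨2, ?_⟩⟩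
  filter_upwards [H ρ hρ hlt] with n hn
  intro Ψ hE hpos hTI y
  have hn1 : (0 : ℝ) < (n : ℝ) + 1 := by positivity
  have hn2 : (0 : ℝ) < (n : ℝ) + 2 := by positivity
  calc _ ≤ ENNReal.ofReal ((n + 2) / (n + 1)) := hn Ψ ⟨hE, hpos, hTI⟩ y
    _ ≤ ENNReal.ofReal (1 + 2 / (n + 2)) := by
        apply ENNReal.ofReal_le_ofReal
        rw [div_le_iff₀ hn1]
        have : (1 + 2 / ((n : ℝ) + 2)) * ((n : ℝ) + 1) = (n + 2) + n / (n + 2) := by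
          field_simp
          ring
        rw [this]
        have : (0 : ℝ) ≤ n / (n + 2) := by positivity
        linarith

/-- S⁺₂ `PairAsymptoticsWithRate`: the thermodynamic limit of the pair density exists UNIFORMLY with
rate `1/N` and a nonpositive infinite-volume correction `h` (Bogoliubov: `h(r) ≈ -ξ'/(π²ρr⁴)` for
`r ≫ ξ`, `ξ' = (16πρa)^{-1/2}`, `< 0` at every `r`; canonical far field `P - 1 ≈ 1/N`). This is the complete finite-size
Bogoliubov picture of `g₂` in the thermodynamic limit — strictly harder than the crux and than anything
in print. [cite: Lieb1963] [cite: LSSY2005, Ch. 5] -/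
def PairAsymptoticsWithRate : Prop :=
  ∀ v : ℝ → ℝ≥0∞, IsRepulsiveFiniteRange v → (∃ M : NNReal, ∀ r, v r ≤ M) →
    ∃ ρ₀ : ℝ, 0 < ρ₀ ∧ ∀ ρ : ℝ, 0 < ρ → ρ < ρ₀ → ∃ h : Space → ℝ, (∀ y, h y ≤ 0) ∧ ∃ C : ℝ,
      ∀ᶠ n : ℕ in atTop, ∀ Ψ : PeriodicTrialState (n + 2) (sideLength ρ (n + 2)),
        IsPosTIGroundState v ρ n Ψ → ∀ y : Space,
          pairDensity ρ n Ψ y ≤ ENNReal.ofReal (1 + h y + C / (n + 2)) ∧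
            ENNReal.ofReal (1 + h y) ≤ pairDensity ρ n Ψ y + ENNReal.ofReal (C / (n + 2))

theorem antibunchingGS_of_pairAsymptotics : PairAsymptoticsWithRate → AntibunchingGS := by
  intro h v hv hM
  obtain ⟨ρ₀, hρ₀, H⟩ := h v hv hM
  refine ⟨ρ₀, hρ₀, fun ρ hρ hlt => ?_⟩
  obtain ⟨hh, hneg, C, HC⟩ := H ρ hρ hlt
  refine ⟨C, ?_⟩
  filter_upwards [HC] with n hn
  intro Ψ hE hpos hTI y
  calc _ ≤ ENNReal.ofReal (1 + hh y + C / (n + 2)) := (hn Ψ ⟨hE, hpos, hTI⟩ y).1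
    _ ≤ ENNReal.ofReal (1 + C / (n + 2)) := ENNReal.ofReal_le_ofReal (by linarith [hneg y])

end

end Summit.AtomisticToContinuum.BoseEinsteinCondensation.Cruxes.AntibunchingGS.StrategistR1
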